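import Mathlib.NumberTheory.NumberField.ClassNumber
import Literature.NumberTheory.EllipticCurves.BSDRootNumberSmallConductorProofs
import Literature.NumberTheory.EllipticCurves.BSDAnalyticRank
import HarnessLib

/-!
# Tian 2014 (Camb. J. Math. 2), *Congruent numbers and Heegner points*: Thm. 1.1, Thm. 1.3, Thm. 5.2 AS PRINTED — the prime `2` for the congruent-number twists `E^{(m)} : my² = x³ − x`

HONEST FRAMING (cell `b2b-bsdres`, sub-lane `bsd-p2`, run/shared/lean/b2b/bsd-rank1-residual/p2/;
literature typer 1, mandate (iv) "p = 2 literature layer typed AS PRINTED"): this file vendors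
PUBLISHED theorems as named `Prop`s (nothing asserted, nothing discharged, D-0014), every printed
hypothesis a binder, with page/line locators into the materialised text. It is EVIDENCE of what
print says at the prime `2` for ONE family (quadratic twists of `y² = x³ − x`, conductor `32`, CM
by `ℤ[i]`); it is not a claim that the `2`-part of the Birch–Swinnerton-Dyer formula holds for
these curves — see the flag below. Numbers of record stay the referee's; nothing booked.

Source. Y. Tian, *Congruent numbers and Heegner points*, Cambridge J. Math. **2** (2014), no. 1,
117–161, doi:10.4310/cjm.2014.v2.n1.a4 [Tian2014] (the seat's payload says "Ann. Math." — the
paper is in Camb. J. Math.; there is no Annals version). Text read: arXiv:1210.8231v1 (31 Oct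
2012), 30 pp., materialised as `paper:arxiv-1210.8231` (`pNNNN` = arXiv PDF page); the theorem
numbering 1.1 / 1.3 / 1.5 / 5.1 / 5.2 / 5.3 of the arXiv text is the one quoted by the citing
literature for the journal version (e.g. Tian–Yuan–Zhang 2017 §1; Tian, ICM 2022 survey
[Tian2023CongruentICM] Thm. 6).

## The printed statements (verbatim, arXiv:1210.8231v1)

* **Theorem 1.1** (p. 1, L30–L33): "For any given integer `k ≥ 0`, there are infinitely many
  square-free congruent numbers with exactly `k + 1` odd prime divisors in each residue class of
  `5`, `6`, and `7` modulo `8`."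
* **Theorem 1.3** (p. 2, L5–L14): "Let `k ≥ 0` be an integer and `n = p₀p₁⋯p_k` a product of
  distinct odd primes with `pᵢ ≡ 1 mod 8` for `1 ≤ i ≤ k`. Assume that the ideal class group `𝒜`
  of the field `K = ℚ(√−2n)` satisfies the condition: (1.1) `dim_{𝔽₂}(𝒜[4]/𝒜[2]) = 0` if
  `n ≡ ±3 mod 8`, `= 1` otherwise. Let `m = n` or `2n` such that `m ≡ 5, 6`, or `7 mod 8`. Let
  `E^{(m)}` be the elliptic curve `my² = x³ − x` over `ℚ`. Then we have
  `rank_ℤ E^{(m)}(ℚ) = 1 = ord_{s=1} L(E^{(m)}, s)`. Moreover, the Shafarevich–Tate group of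
  `E^{(m)}` is finite and has odd cardinality." (For an abelian group `A`, `A[d]` = kernel of
  multiplication by `d`, p. 2 L3–L4.)
* **Remark 1.4** (p. 2, L15–L22) — THE `p = 2` FLAG OF THIS FILE: "The work of Perrin-Riou [21]
  and Kobayshi [13] shows that the order of the `p`-primary subgroup of the Tate–Shafarevich group
  of `E^{(m)}` is as predicted by the conjecture of Birch and Swinnerton-Dyer for all primes `p`
  with `(p, 2m) = 1`. At present, it is unknown whether the same statement holds for the primes
  `p` dividing `2m`, so that the full Birch–Swinnerton-Dyer conjecture is still not quite
  completely known for the curves `E^{(m)}`. However, toward to the conjecture for `p = 2` we have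
  Theorem 1.5 below in viewing of Gross–Zagier formula." So: THIS PAPER EXCLUDES `p = 2` (and
  `p ∣ m`) from the `p`-part of the BSD formula; what it proves 2-adically is `Ш(E^{(m)})[2] = 0`
  (Thm. 1.3, via Lemma 5.3's `2`-Selmer count (5.1)) and the exact `2`-divisibility `2^{k+1} ∥`
  of the Heegner point `P_χ(f)` (Thm. 1.5), NOT `ord₂ #Ш_an(E^{(m)}) = 0`. (The `2`-part of the
  formula for this family is attributed by Tian's ICM survey [Tian2023CongruentICM], p. 1993,
  to "[51], [50]" = Tian–Yuan–Zhang 2017 together with this paper; it is typed in the sibling file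
  `TianYuanZhang2017/GenusPeriodsParity.lean`, not here.)
* **Theorem 1.5** (p. 3, L19–L31; main theorem): with `n, m` as in Thm. 1.3, `K = ℚ(√−2n)`, `H`
  its Hilbert class field, `m* = (−1)^{(n−1)/2} m`, `χ` the character of `Gal(H(i)/K)` cutting out
  `K(√m*)`, `f : X₀(32) → E` the degree-`2` parametrisation of `E : y² = x³ − x` with `f([∞]) = 0`,
  `P = [i√(2n)/8]` (`n ≡ 5 mod 8`) resp. `[(i√(2n)+2)/8]` (`n ≡ 6, 7 mod 8` [sic; `m ≡ 6, 7`]):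
  "the point `f(P)` is defined over `H(i)`; and the `χ`-component
  `P_χ(f) := ∑_{σ ∈ Gal(H(i)/K)} f(P)^σ χ(σ)` satisfies `P_χ(f) ∈ 2^{k+1} E(ℚ(√m*))⁻` and
  `P_χ(f) ∉ 2^{k+2} E(ℚ(√m*))⁻ + E[2]`. In particular, `P_χ(f) ∈ E(ℚ(√m*))⁻ ≅ E^{(m)}(ℚ)` is of
  infinite order and `m` is a congruent number." — NOT typed here (it needs the CM points on
  `X₀(32)` and the `χ`-isotypic trace; the tree's `ModularParametrizationData`/`heegnerTau` cover
  `Γ₀(N)`-Heegner points of fundamental discriminant prime to `N`, which `−8n` at level `32` is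
  not); recorded for the `2`-adic transport seats as the printed source of the exact
  `2`-divisibility of the Heegner point.
* **Lemma 5.1** (p. 28, L1–L12): condition (1.1) ⟺ (1) the graph `G` on `{p₀,…,p_k}` with edges
  `pᵢpⱼ` for `(pᵢ/pⱼ) = −1` has no proper even partition ⟺ (2) `G` has an odd number of spanning
  subtrees; proof, L13–L16: "the multiplication by `2` induces an isomorphism
  `𝒜[4]/𝒜[2] ≃ 𝒜[2] ∩ 2𝒜`. The condition (1.1) is the same as `2𝒜 ∩ 𝒜[2] = 0` if
  `n ≡ ±3 mod 8`; `{0, [ϖ]}` otherwise" — the form in which (1.1) is typed below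
  (`fourTwoCard`).
* **Theorem 5.2** (p. 28, L40–L43): "Let `p₀ ≢ 1 mod 8` be an odd prime. Then there exists an
  infinite set `Σ` of primes congruent to `1` modulo `8` such that the product of `p₀` (resp.
  `2p₀`) and primes in any finite subset of `Σ` is a congruent number if `p₀ ≡ 5, 7 mod 8` (resp.
  `p₀ ≡ 3 mod 4`)."
* **Lemma 5.3** (pp. 28–29): for `n, m` as in Thm. 1.3, with `ϕ : E^{(m)} → E′^{(m)} : my² = x³ + 4x`
  the `2`-isogeny with kernel `{0, (0,0)}` and `ψ` its dual, condition (1.1) implies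
  `dim_{𝔽₂} S(ϕ) = 1`, `dim_{𝔽₂} S(ψ) = 2` and (5.1) `dim_{𝔽₂} S^{(2)}(E^{(m)}/ℚ)/E^{(m)}[2] = 1`
  — NOT typed here (the tree has no `2`-Selmer group of an elliptic curve over `ℚ` as a finite
  `𝔽₂`-space with its torsion image; its content enters Thm. 1.3 as `Ш[2] = 0`); recorded.
* Proof of Thm. 1.3 (p. 29, L33–L45): infinite order of `P_χ(f)` (Thm. 1.5) + Kolyvagin ⇒ rank
  one and `Ш` finite; generalized Gross–Zagier ([27] = Yuan–Zhang–Zhang, Thm. 1.2) +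
  `L(E^{(1)},1) L(E^{(2)},1) ≠ 0` ⇒ `ord_{s=1} = 1`; (5.1) ⇒ `rank + dim Ш[2] = 1` ⇒ `Ш[2] = 0`.

## Transcription (tree dictionary)

* `E^{(m)} : my² = x³ − x` is typed as the tree's `congruentNumberCurve m : y² = x³ − m²x`
  (`BSDAnalyticRank`), `ℚ`-isomorphic to it by `(x, y) ↦ (mx, m²y)`; Mordell–Weil rank
  (`WeierstrassCurve.mordellWeilRank`), analytic rank (`WeierstrassCurve.analyticRank`,
  `ord_{s=1}` of the entire `L`-function) and `Ш` (`WeierstrassCurve.sha`, its cardinality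
  `Nat.card`) are `ℚ`-isomorphism invariants, so nothing changes.
* "`n = p₀p₁⋯p_k` a product of distinct odd primes with `pᵢ ≡ 1 mod 8` for `1 ≤ i ≤ k`": an
  injective family `p : Fin (k+1) → ℕ` of primes `≠ 2` with `p i % 8 = 1` for `i ≠ 0` and
  `n = ∏ i, p i` (the letter of the theorem puts no congruence condition on `p₀`; `m ≡ 5, 6, 7 mod 8`
  forces `p₀ ≢ 1 mod 8`, as Lemma 5.1 / Thm. 5.2 / the proof p. 27 L44–L46 make explicit).
* "the ideal class group `𝒜` of `K = ℚ(√−2n)`": `ClassGroup (𝓞 K)` (Mathlib) for a number field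
  `K` with `[K : ℚ] = 2` containing a square root of `−2n` (`IsQuadraticFieldOfSqrt K (−2n)`; such
  `K` is `ℚ(√−2n)` up to isomorphism, and `−2n` is not a rational square).
* (1.1) is typed in Tian's own equivalent form (proof of Lemma 5.1): `#(2𝒜 ∩ 𝒜[2]) = 1` if
  `n ≡ ±3 mod 8`, `= 2` otherwise (`fourTwoCard`; `2^{dim 𝒜[4]/𝒜[2]} = #(2𝒜 ∩ 𝒜[2])`; Mathlib's
  `ClassGroup` is written multiplicatively: `2𝒜 = {squares}`, `𝒜[2] = {a | a² = 1}`).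
* "congruent number": the tree's `IsCongruentNumber` (`BSDWave0`: area of a rational right
  triangle).
No `_holds` is expected for any of the three facts (Heegner points on `X₀(32)`, Kolyvagin's Euler
system, the Yuan–Zhang–Zhang formula). Consumers take `(h : thm13_rank_one_and_sha_odd)` etc.

## References
* [Tian2014] Y. Tian, Camb. J. Math. 2 (2014) 117–161 = arXiv:1210.8231: Thm. 1.1 (p. 1), Thm. 1.3,
  Rem. 1.4 (p. 2), Thm. 1.5 (p. 3), Lemma 5.1, Thm. 5.2 (p. 28), Lemma 5.3, proof of Thm. 1.3 (p. 29).
* [Tian2023CongruentICM] Y. Tian, ICM 2022 Proceedings (EMS 2023) 1990–2010, Thm. 2 and the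
  paragraph after it (p. 1993), Thm. 6, Thm. 8 (p. 1996).
* [TianYuanZhang2017] Y. Tian, X. Yuan, S.-W. Zhang, Asian J. Math. 21 (2017) 721–774, §1.
-/

noncomputable section

open scoped Classical

open NumberField WeierstrassCurve Literature.NumberTheory.EllipticCurves

namespace Literature.NumberTheory.EllipticCurves.Tian2014

/-! ### Vocabulary (definitions with bodies; nothing asserted) -/

/-- "`K = ℚ(√d)`" for a number field `K` and an integer `d`: `[K : ℚ] = 2` and `d` has a square
root in `K` (for `d` not a rational square this pins `K` down up to isomorphism as `ℚ(√d)`; used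
below with `d = −2n < 0`). Tian 2014, Thm. 1.3: "the field `K = ℚ(√−2n)`". [cite: Tian2014, Thm. 1.3 (arXiv p. 2, L6–L7)] -/
def IsQuadraticFieldOfSqrt (K : Type*) [Field K] [NumberField K] (d : ℤ) : Prop :=
  Module.finrank ℚ K = 2 ∧ ∃ x : K, x ^ 2 = (d : K)

/-- `#(2𝒜 ∩ 𝒜[2])` for a (multiplicatively written) abelian group `𝒜`: the number of squares of
order dividing `2`. By "the multiplication by `2` induces an isomorphism `𝒜[4]/𝒜[2] ≃ 𝒜[2] ∩ 2𝒜`"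
(Tian 2014, proof of Lemma 5.1) this number is `2^{dim_{𝔽₂}(𝒜[4]/𝒜[2])}` for a finite `𝒜`
(the `4`-rank of `𝒜` in the exponent). [cite: Tian2014, proof of Lemma 5.1 (arXiv p. 28, L13–L16)] -/
def fourTwoCard (A : Type*) [CommGroup A] : ℕ :=
  Nat.card {a : A // IsSquare a ∧ a ^ 2 = 1}

/-- Unfolding of `fourTwoCard` (by definition). [cite: Tian2014, proof of Lemma 5.1 (arXiv p. 28)] -/
theorem fourTwoCard_def (A : Type*) [CommGroup A] :
    fourTwoCard A = Nat.card {a : A // IsSquare a ∧ a ^ 2 = 1} := rfl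

/-- Tian's **condition (1.1)** on the class group `𝒜 = Cl(K)`, `K = ℚ(√−2n)`, in the equivalent form
of the proof of Lemma 5.1: "`2𝒜 ∩ 𝒜[2] = 0` if `n ≡ ±3 mod 8`; `{0, [ϖ]}` otherwise", i.e.
`#(2𝒜 ∩ 𝒜[2]) = 1` if `n % 8 ∈ {3, 5}` and `= 2` otherwise (printed form: `dim_{𝔽₂}(𝒜[4]/𝒜[2]) = 0`
resp. `1`). A predicate on `(n, K)`; nothing asserted.
[cite: Tian2014, Thm. 1.3 (1.1) (arXiv p. 2, L8–L10) and proof of Lemma 5.1 (p. 28, L13–L16)] -/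
def Condition11 (n : ℕ) (K : Type*) [Field K] [NumberField K] : Prop :=
  fourTwoCard (ClassGroup (𝓞 K)) = if n % 8 = 3 ∨ n % 8 = 5 then 1 else 2

/-! ### The three printed theorems (named facts; nothing asserted) -/

/-- **Tian 2014, Theorem 1.3** (verbatim in the module docstring). For `k ≥ 0`, distinct odd primes
`p₀, …, p_k` with `pᵢ ≡ 1 (mod 8)` for `1 ≤ i ≤ k`, `n = p₀⋯p_k`, `K = ℚ(√−2n)` a quadratic field whose
class group satisfies (1.1) (`Condition11 n K`), and `m ∈ {n, 2n}` with `m ≡ 5, 6, 7 (mod 8)`: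
`rank_ℤ E^{(m)}(ℚ) = 1 = ord_{s=1} L(E^{(m)}, s)` and `Ш(E^{(m)}/ℚ)` is finite of ODD cardinality
(`E^{(m)} : my² = x³ − x ≅_ℚ congruentNumberCurve m`). What this says at `p = 2`: `Ш(E^{(m)})[2^∞] = 0`;
it does NOT say `ord₂ #Ш_an = 0` (Remark 1.4 of the source: the `p`-part of the formula is known there
only for `(p, 2m) = 1`). No `_holds` expected.
[cite: Tian2014, Thm. 1.3 (arXiv:1210.8231 p. 2, L5–L14); proof p. 29, L33–L45; Rem. 1.4 (p. 2, L15–L22)] -/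
def thm13_rank_one_and_sha_odd : Prop :=
  ∀ (k : ℕ) (p : Fin (k + 1) → ℕ),
    (∀ i, (p i).Prime) → (∀ i, p i ≠ 2) → Function.Injective p →
    (∀ i, i ≠ 0 → p i % 8 = 1) →
    ∀ (n : ℕ), n = ∏ i, p i →
    ∀ (K : Type) [Field K] [NumberField K],
      IsQuadraticFieldOfSqrt K (-(2 * n : ℤ)) → Condition11 n K →
      ∀ (m : ℕ), (m = n ∨ m = 2 * n) → (m % 8 = 5 ∨ m % 8 = 6 ∨ m % 8 = 7) →
        (congruentNumberCurve m).mordellWeilRank = 1 ∧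
        (congruentNumberCurve m).analyticRank = 1 ∧
        Finite (congruentNumberCurve m).sha ∧
        Odd (Nat.card (congruentNumberCurve m).sha)

/-- **Tian 2014, Theorem 1.1** (verbatim in the module docstring): for every `k ≥ 0` and each residue
class `r ∈ {5, 6, 7}` modulo `8` there are infinitely many square-free congruent numbers `n ≡ r (mod 8)`
with exactly `k + 1` odd prime divisors (`IsCongruentNumber` of `BSDWave0`). No `_holds` expected
(it is deduced from Thm. 1.5 via Lemma 5.1 and Dirichlet's theorem, p. 28 L36–L38).
[cite: Tian2014, Thm. 1.1 (arXiv:1210.8231 p. 1, L30–L33)] -/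
def thm11_infinitely_many_congruent_numbers : Prop :=
  ∀ (k r : ℕ), (r = 5 ∨ r = 6 ∨ r = 7) →
    {n : ℕ | Squarefree n ∧ n % 8 = r ∧ (n.primeFactors.filter Odd).card = k + 1 ∧
      IsCongruentNumber n}.Infinite

/-- **Tian 2014, Theorem 5.2** (verbatim in the module docstring): for every odd prime
`p₀ ≢ 1 (mod 8)` there is an infinite set `Σ` of primes `≡ 1 (mod 8)` such that for every finite
`S ⊆ Σ` the number `p₀ · ∏_{p ∈ S} p` is congruent if `p₀ ≡ 5, 7 (mod 8)`, and `2p₀ · ∏_{p ∈ S} p` is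
congruent if `p₀ ≡ 3 (mod 4)` (the proof chooses `Σ = {p₁, p₂, …}` with `(pᵢ/p₀) = −1`,
`(pᵢ/pⱼ) = 1`, a star-shaped graph, so that (1.1) holds). No `_holds` expected.
[cite: Tian2014, Thm. 5.2 (arXiv:1210.8231 p. 28, L40–L43), proof L44–L55] -/
def thm52_congruent_products_over_infinite_prime_set : Prop :=
  ∀ (p₀ : ℕ), p₀.Prime → p₀ ≠ 2 → p₀ % 8 ≠ 1 →
    ∃ P : Set ℕ, P.Infinite ∧ (∀ p ∈ P, p.Prime ∧ p % 8 = 1) ∧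
      ∀ S : Finset ℕ, (↑S : Set ℕ) ⊆ P →
        ((p₀ % 8 = 5 ∨ p₀ % 8 = 7) → IsCongruentNumber (p₀ * ∏ p ∈ S, p)) ∧
        (p₀ % 4 = 3 → IsCongruentNumber (2 * p₀ * ∏ p ∈ S, p))

/-! ### Bookkeeping at the prime `2` (proved; what Thm. 1.3 gives and does not give) -/

/-- From Thm. 1.3: for `m` in Tian's family, `Ш(E^{(m)}/ℚ)` has no element of order `2`, i.e. the
`2`-primary part `Ш(E^{(m)})(2)` is trivial (a finite group of odd order has trivial `2`-primary
component). This is the full `2`-adic ALGEBRAIC content of Thm. 1.3; the analytic side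
`ord₂ #Ш_an(E^{(m)})` is not addressed by the theorem (Remark 1.4). Pure group theory from the fact.
[cite: Tian2014, Thm. 1.3 and Rem. 1.4 (arXiv p. 2)] -/
theorem card_primaryComponent_two_eq_one_of_thm13 (h : thm13_rank_one_and_sha_odd)
    (k : ℕ) (p : Fin (k + 1) → ℕ) (hp : ∀ i, (p i).Prime) (hp2 : ∀ i, p i ≠ 2)
    (hinj : Function.Injective p) (h8 : ∀ i, i ≠ 0 → p i % 8 = 1) (n : ℕ) (hn : n = ∏ i, p i)
    (K : Type) [Field K] [NumberField K] (hK : IsQuadraticFieldOfSqrt K (-(2 * n : ℤ)))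
    (h11 : Condition11 n K) (m : ℕ) (hm : m = n ∨ m = 2 * n)
    (hm8 : m % 8 = 5 ∨ m % 8 = 6 ∨ m % 8 = 7) :
    Nat.card (AddCommGroup.primaryComponent (congruentNumberCurve m).sha 2) = 1 := by
  obtain ⟨-, -, hfin, hodd⟩ := h k p hp hp2 hinj h8 n hn K hK h11 m hm hm8
  haveI := hfin
  haveI : Fact (2 : ℕ).Prime := ⟨Nat.prime_two⟩
  rw [card_addPrimaryComponent_eq_pow, Nat.factorization_eq_zero_of_not_dvd hodd.not_two_dvd_nat,
    pow_zero]

end Literature.NumberTheory.EllipticCurves.Tian2014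

end
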